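import Summits.KontsevichZagierPeriods.KontsevichZagierPeriods.Theorems.CobordismMoveZeroCombination
import Summits.KontsevichZagierPeriods.KontsevichZagierPeriods.Theorems.CobordismMoveCubeCoordinateCycle
import Summits.KontsevichZagierPeriods.KontsevichZagierPeriods.Theorems.CobordismMoveCubeLastNewtonLeibniz

/-!
# `CubeStokes` (stmt-KontsevichZagierPeriods-5566, route CobordismMove) — proof

CLOSED-FORM STOKES ON THE UNIT CUBE IS A RELATION of the fixed Kontsevich–Zagier calculus of moves:
for `ℚ`-semialgebraic coefficients `A₀, …, A_d` continuous on `[0,1]^(d+1)` with partials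
`A'_k = ∂_k A_k` on the open cube (`ℚ`-semialgebraic, absolutely integrable) satisfying the
closedness `Σ_k (−1)^k A'_k = 0`, the signed sum `Σ_k Σ_{s=0,1} (−1)^(k+s) [face_kˢ]` of the
`2(d+1)` face representations lies in `KZ.relations`.

The proof is the crux strategist's typed decomposition with ALL pieces proved (landed as the three
sibling modules imported above):

* P1 `CubeLastNewtonLeibniz` (stmt-17771, `Theorems/CobordismMoveCubeLastNewtonLeibniz.lean`) —
  Newton–Leibniz along the last coordinate of the open cube with bulk term;
* P2 `CubeCoordinateCycle` (stmt-17772, `Theorems/CobordismMoveCubeCoordinateCycle.lean`) — cycling a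
  coordinate to the last slot is ONE rule-(2) move for an arbitrary integrand;
* P3 `ZeroCombination` (stmt-17773, `Theorems/CobordismMoveZeroCombination.lean`) — a
  `ℤ`-combination on a common domain whose integrands combine to `0` pointwise is a relation;
* the assembly `CubeStokesSplit.cubeStokes_of_subs : CubeLastNewtonLeibniz → CubeCoordinateCycle →
  ZeroCombination → CubeStokes` (this file): for each coordinate `k` the coefficient `A_k` and its
  partial `A'_k` are TRANSPORTED through the coordinate cycle `z ↦ insertNth k (z last) (init z)`
  (semialgebraicity by relabelling coordinates, continuity, absolute integrability by the
  volume-preserving relabelling `MeasurableEquiv.piCongrLeft`, the fibrewise derivative through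
  `Function.update ∘ Fin.insertNth`), the honest bulk representations `R_k = [(0,1)^(d+1), A'_k]`
  and their cycled copies `R̃_k` are built; P2 gives `[R_k] − [R̃_k] ∈ relations`, P1 gives
  `[R̃_k] − [face_k¹] + [face_k⁰] ∈ relations`, P3 with the closedness gives
  `Σ_k (−1)^k [R_k] ∈ relations`, and the signs are collected in the free abelian group;
* `cubeStokes_proof : CubeStokes`, the assembly fed with the three landed pieces.

This is §4 of the crux strategist's complete sorry-free proof
`Summits/KontsevichZagierPeriods/KontsevichZagierPeriods/Cruxes/CubeStokes/CubeStokesProof.lean`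
(seat planner-cstrat-stmt-KontsevichZagierPeriods-5566-r1-0, 2026-08-17; assembly also published as
`Cruxes/CubeStokes/StrategistSplit.lean`), re-homed under `Theorems/` by lead c10 of crux
stmt-KontsevichZagierPeriods-9129 (banking): the helper lemmas verbatim (the two coordinate-cycle
lemmas `exists_perm_insertNth`, `comp_perm_mem_setOf_iff` are taken from the landed P2 module
instead of being repeated), the hypotheses of `cubeStokes_of_subs` stated as the three route
declarations by name, its body verbatim. No definitions are introduced.

References: M. Kontsevich, D. Zagier, *Periods* (2001), §1.2, rules (1)–(3) ("in several variables
one replaces the Newton–Leibniz formula by Stokes's formula"); A. Huber, S. Müller-Stach, *Periods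
and Nori Motives* (2017), §13.1; J. Bochnak, M. Coste, M.-F. Roy, *Real Algebraic Geometry* (1998),
§2.2.
-/

noncomputable section

open MeasureTheory Set
open Literature.NumberTheory.Transcendental
open Literature.ModelTheory.ExponentialFields (IsSemialgebraic)

namespace Summit.KontsevichZagierPeriods.CobordismMove

open Summit.KontsevichZagierPeriods.KontsevichZagierPeriods.Theses.CobordismMove

namespace CubeStokesSplit

open CubeCoordinateCycle (exists_perm_insertNth comp_perm_mem_setOf_iff)

variable {d : ℕ}

/-! ### Transport through coordinate relabellings -/

/-- The closed unit cube is invariant under relabelling coordinates. [folklore] -/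
theorem comp_perm_mem_Icc_iff {n : ℕ} (e : Equiv.Perm (Fin n)) (z : Fin n → ℝ) :
    (fun i => z (e i)) ∈ Icc (0 : Fin n → ℝ) 1 ↔ z ∈ Icc (0 : Fin n → ℝ) 1 := by
  simp only [mem_Icc, Pi.le_def, Pi.zero_apply, Pi.one_apply]
  constructor
  · rintro ⟨h0, h1⟩
    exact ⟨fun i => by simpa using h0 (e.symm i), fun i => by simpa using h1 (e.symm i)⟩
  · rintro ⟨h0, h1⟩
    exact ⟨fun i => h0 (e i), fun i => h1 (e i)⟩

/-- Semialgebraicity on the open unit cube is invariant under relabelling coordinates.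
[cite: BCR1998, §2.2] -/
theorem isSemialgebraicFunOn_comp_perm_setOf {n : ℕ} (e : Equiv.Perm (Fin n))
    {f : (Fin n → ℝ) → ℝ} (hf : IsSemialgebraicFunOn ℚ {x : Fin n → ℝ | ∀ i, x i ∈ Ioo (0 : ℝ) 1} f) :
    IsSemialgebraicFunOn ℚ {x : Fin n → ℝ | ∀ i, x i ∈ Ioo (0 : ℝ) 1}
      (fun z => f (fun i => z (e i))) := by
  have h := hf.comp_equiv e
  have hset : {w : Fin n → ℝ | (fun i => w (e i)) ∈ {x : Fin n → ℝ | ∀ i, x i ∈ Ioo (0 : ℝ) 1}} =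
      {x : Fin n → ℝ | ∀ i, x i ∈ Ioo (0 : ℝ) 1} := by
    ext w
    exact comp_perm_mem_setOf_iff e w
  rwa [hset] at h

/-- Semialgebraicity on the closed unit cube is invariant under relabelling coordinates.
[cite: BCR1998, §2.2] -/
theorem isSemialgebraicFunOn_comp_perm_Icc {n : ℕ} (e : Equiv.Perm (Fin n))
    {f : (Fin n → ℝ) → ℝ} (hf : IsSemialgebraicFunOn ℚ (Icc (0 : Fin n → ℝ) 1) f) :
    IsSemialgebraicFunOn ℚ (Icc (0 : Fin n → ℝ) 1) (fun z => f (fun i => z (e i))) := by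
  have h := hf.comp_equiv e
  have hset : {w : Fin n → ℝ | (fun i => w (e i)) ∈ Icc (0 : Fin n → ℝ) 1} =
      Icc (0 : Fin n → ℝ) 1 := by
    ext w
    exact comp_perm_mem_Icc_iff e w
  rwa [hset] at h

/-- Relabelling coordinates is continuous. [folklore] -/
theorem continuous_comp_perm {n : ℕ} (e : Equiv.Perm (Fin n)) :
    Continuous (fun z : Fin n → ℝ => fun i => z (e i)) :=
  continuous_pi fun i => continuous_apply (e i)

/-- Absolute integrability on the open unit cube is invariant under relabelling coordinates: the
relabelling is the volume-preserving `MeasurableEquiv.piCongrLeft` and preserves the cube.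
[folklore] -/
theorem integrableOn_comp_perm_setOf {n : ℕ} (e : Equiv.Perm (Fin n)) {f : (Fin n → ℝ) → ℝ}
    (hf : IntegrableOn f {x : Fin n → ℝ | ∀ i, x i ∈ Ioo (0 : ℝ) 1}) :
    IntegrableOn (fun z => f (fun i => z (e i))) {x : Fin n → ℝ | ∀ i, x i ∈ Ioo (0 : ℝ) 1} := by
  set L : (Fin n → ℝ) ≃ᵐ (Fin n → ℝ) := MeasurableEquiv.piCongrLeft (fun _ : Fin n => ℝ) e.symm
    with hL_def
  have hL : MeasurePreserving L volume volume :=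
    volume_measurePreserving_piCongrLeft (fun _ : Fin n => ℝ) e.symm
  have hLapply : ∀ z : Fin n → ℝ, L z = fun i => z (e i) := by
    intro z
    funext i
    have h := Equiv.piCongrLeft_apply_apply (fun _ : Fin n => ℝ) e.symm z (e i)
    rw [hL_def, MeasurableEquiv.coe_piCongrLeft]
    simpa using h
  have hpre : L ⁻¹' {x : Fin n → ℝ | ∀ i, x i ∈ Ioo (0 : ℝ) 1} =
      {x : Fin n → ℝ | ∀ i, x i ∈ Ioo (0 : ℝ) 1} := by
    ext z
    rw [mem_preimage, hLapply]
    exact comp_perm_mem_setOf_iff e z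
  have h := (hL.integrableOn_comp_preimage L.measurableEmbedding (f := f)
    (s := {x : Fin n → ℝ | ∀ i, x i ∈ Ioo (0 : ℝ) 1})).mpr hf
  rw [hpre] at h
  exact h.congr_fun (fun z _ => by simp only [Function.comp_apply, hLapply])
    (KZ.isOpen_unitCube n).measurableSet

/-- Updating the inserted coordinate. [folklore] -/
theorem update_insertNth (k : Fin (d + 1)) (t s : ℝ) (y : Fin d → ℝ) :
    Function.update (Fin.insertNth k t y : Fin (d + 1) → ℝ) k s = Fin.insertNth k s y := by
  rw [KZ.insertNth_eq_update k t y, KZ.insertNth_eq_update k s y, Function.update_idem]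

/-- Inserting a coordinate in `(0,1)` into a point of the open `d`-cube gives a point of the open
`(d+1)`-cube. [folklore] -/
theorem insertNth_mem_setOf (k : Fin (d + 1)) {t : ℝ} (ht : t ∈ Ioo (0 : ℝ) 1) {y : Fin d → ℝ}
    (hy : y ∈ {y : Fin d → ℝ | ∀ i, y i ∈ Ioo (0 : ℝ) 1}) :
    (Fin.insertNth k t y : Fin (d + 1) → ℝ) ∈ {x : Fin (d + 1) → ℝ | ∀ i, x i ∈ Ioo (0 : ℝ) 1} := by
  simp only [mem_setOf_eq] at hy ⊢
  intro i
  rcases Fin.eq_self_or_eq_succAbove k i with rfl | ⟨j, rfl⟩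
  · simpa [Fin.insertNth_apply_same] using ht
  · simpa [Fin.insertNth_apply_succAbove] using hy j

/-! ### The assembly -/

/-- **`CubeStokes` from its three pieces** (glue of the split
`CubeLastNewtonLeibniz → CubeCoordinateCycle → ZeroCombination → CubeStokes` of route
CobordismMove; the three hypotheses are the three route declarations by name).
For each coordinate `k` the coefficient `A_k` and its partial `A'_k` are transported through the
coordinate cycle `z ↦ insertNth k (z last) (init z)` (semialgebraicity, continuity, integrability,
fibrewise derivative), the bulk representation `R_k = [(0,1)^(d+1), A'_k]` and its cycled copy
`R̃_k` are built; (P2) gives `[R_k] − [R̃_k] ∈ relations`, (P1) gives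
`[R̃_k] − [face_k¹] + [face_k⁰] ∈ relations`, (P3) with the closedness
`Σ_k (−1)^k A'_k = 0` gives `Σ_k (−1)^k [R_k] ∈ relations`, and
`Σ_k Σ_s (−1)^(k+s) [face_kˢ] = Σ_k (−1)^k (([R̃_k] − [face_k¹] + [face_k⁰]) + ([R_k] − [R̃_k])) − Σ_k (−1)^k [R_k]`.
[cite: KontsevichZagier2001, §1.2] -/
theorem cubeStokes_of_subs (h₁ : CubeLastNewtonLeibniz) (h₂ : CubeCoordinateCycle)
    (h₃ : ZeroCombination) : CubeStokes := by
  intro d A A' rf hA hA' hcont hder hint hclosed hdom hface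
  -- index permutations realising the coordinate cycles `z ↦ insertNth k (z last) (init z)`
  choose e he using fun k : Fin (d + 1) => exists_perm_insertNth (d := d) k
  -- (a) transport of the coefficient data through the cycles
  have hBsa : ∀ k : Fin (d + 1), IsSemialgebraicFunOn ℚ (Icc (0 : Fin (d + 1) → ℝ) 1)
      (fun z => A k (Fin.insertNth k (z (Fin.last d)) (Fin.init z))) := fun k =>
    (isSemialgebraicFunOn_comp_perm_Icc (e k) (hA k)).congr fun z _ => congrArg (A k) (he k z)
  have hB'sa : ∀ k : Fin (d + 1), IsSemialgebraicFunOn ℚ {x : Fin (d + 1) → ℝ | ∀ i, x i ∈ Ioo (0 : ℝ) 1}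
      (fun z => A' k (Fin.insertNth k (z (Fin.last d)) (Fin.init z))) := fun k =>
    (isSemialgebraicFunOn_comp_perm_setOf (e k) (hA' k)).congr fun z _ => congrArg (A' k) (he k z)
  have hB'int : ∀ k : Fin (d + 1),
      IntegrableOn (fun z => A' k (Fin.insertNth k (z (Fin.last d)) (Fin.init z)))
        {x : Fin (d + 1) → ℝ | ∀ i, x i ∈ Ioo (0 : ℝ) 1} := fun k =>
    (integrableOn_comp_perm_setOf (e k) (hint k)).congr_fun (fun z _ => congrArg (A' k) (he k z))
      (KZ.isOpen_unitCube (d + 1)).measurableSet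
  have hBcont : ∀ k : Fin (d + 1),
      ContinuousOn (fun z => A k (Fin.insertNth k (z (Fin.last d)) (Fin.init z)))
        (Icc (0 : Fin (d + 1) → ℝ) 1) := by
    intro k
    have h : ContinuousOn (fun z : Fin (d + 1) → ℝ => A k (fun i => z (e k i)))
        (Icc (0 : Fin (d + 1) → ℝ) 1) :=
      (hcont k).comp (continuous_comp_perm (e k)).continuousOn fun z hz =>
        (comp_perm_mem_Icc_iff (e k) z).2 hz
    exact h.congr fun z _ => (congrArg (A k) (he k z)).symm
  have hBder : ∀ k : Fin (d + 1), ∀ y ∈ {y : Fin d → ℝ | ∀ i, y i ∈ Ioo (0 : ℝ) 1},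
      ∀ t ∈ Ioo (0 : ℝ) 1,
      HasDerivAt
        (fun s : ℝ => A k (Fin.insertNth k ((Fin.snoc y s : Fin (d + 1) → ℝ) (Fin.last d))
          (Fin.init (Fin.snoc y s : Fin (d + 1) → ℝ))))
        (A' k (Fin.insertNth k ((Fin.snoc y t : Fin (d + 1) → ℝ) (Fin.last d))
          (Fin.init (Fin.snoc y t : Fin (d + 1) → ℝ)))) t := by
    intro k y hy t ht
    simp only [Fin.snoc_last, Fin.init_snoc]
    have hx : (Fin.insertNth k t y : Fin (d + 1) → ℝ) ∈
        {x : Fin (d + 1) → ℝ | ∀ i, x i ∈ Ioo (0 : ℝ) 1} := insertNth_mem_setOf k ht hy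
    have h := hder k _ hx
    simp only [Fin.insertNth_apply_same, update_insertNth] at h
    exact h
  -- (b) the bulk representations `R k = [(0,1)^(d+1), A' k]` and their cycled copies `Rt k`
  have hUsa : IsSemialgebraic ℚ {x : Fin (d + 1) → ℝ | ∀ i, x i ∈ Ioo (0 : ℝ) 1} :=
    KZ.isSemialgebraic_unitCube (d + 1)
  have hRex : ∀ k : Fin (d + 1), ∃ Rk : KZ.IntegralRep (d + 1),
      Rk.domain = {x : Fin (d + 1) → ℝ | ∀ i, x i ∈ Ioo (0 : ℝ) 1} ∧ Rk.integrand = A' k := fun k =>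
    ⟨⟨{x | ∀ i, x i ∈ Ioo (0 : ℝ) 1}, A' k, hUsa, hA' k, hint k⟩, rfl, rfl⟩
  choose R hRd hRi using hRex
  have hRtex : ∀ k : Fin (d + 1), ∃ Rk : KZ.IntegralRep (d + 1),
      Rk.domain = {x : Fin (d + 1) → ℝ | ∀ i, x i ∈ Ioo (0 : ℝ) 1} ∧
        Rk.integrand = fun z => A' k (Fin.insertNth k (z (Fin.last d)) (Fin.init z)) := fun k =>
    ⟨⟨{x | ∀ i, x i ∈ Ioo (0 : ℝ) 1}, fun z => A' k (Fin.insertNth k (z (Fin.last d)) (Fin.init z)),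
      hUsa, hB'sa k, hB'int k⟩, rfl, rfl⟩
  choose Rt hRtd hRti using hRtex
  -- (c) the three pieces
  have h2 : ∀ k : Fin (d + 1), KZ.of (R k) - KZ.of (Rt k) ∈ KZ.relations := fun k =>
    h₂ d k (R k) (Rt k) (hRd k) (hRtd k) fun z _ => by rw [hRti k, hRi k]
  have h1 : ∀ k : Fin (d + 1), KZ.of (Rt k) - KZ.of (rf k 1) + KZ.of (rf k 0) ∈ KZ.relations := by
    intro k
    refine h₁ d (fun z => A k (Fin.insertNth k (z (Fin.last d)) (Fin.init z)))
      (fun z => A' k (Fin.insertNth k (z (Fin.last d)) (Fin.init z))) (Rt k) (rf k 0) (rf k 1)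
      (hBsa k) (hBcont k) (hBder k) (hRtd k) (fun z _ => by rw [hRti k]) (hdom k 0) (hdom k 1)
      ?_ ?_
    · intro y hy
      rw [hface k 0 hy]
      simp
    · intro y hy
      rw [hface k 1 hy]
      simp
  have h3 : (∑ k : Fin (d + 1), ((-1 : ℤ) ^ (k : ℕ)) • KZ.of (R k)) ∈ KZ.relations := by
    refine h₃ (d + 1) (d + 1) {x : Fin (d + 1) → ℝ | ∀ i, x i ∈ Ioo (0 : ℝ) 1} R
      (fun k => (-1 : ℤ) ^ (k : ℕ)) (fun k => hRd k) fun x hx => ?_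
    have h := hclosed x hx
    simp only [hRi]
    push_cast
    exact h
  -- (d) signs in the free abelian group
  have key : ∀ k : Fin (d + 1),
      (∑ s : Fin 2, ((-1 : ℤ) ^ ((k : ℕ) + (s : ℕ))) • KZ.of (rf k s)) =
        ((-1 : ℤ) ^ (k : ℕ)) • ((KZ.of (Rt k) - KZ.of (rf k 1) + KZ.of (rf k 0)) +
          (KZ.of (R k) - KZ.of (Rt k))) - ((-1 : ℤ) ^ (k : ℕ)) • KZ.of (R k) := by
    intro k
    rw [Fin.sum_univ_two]
    simp only [Fin.val_zero, Fin.val_one]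
    module
  rw [Finset.sum_congr rfl fun k _ => key k, Finset.sum_sub_distrib]
  exact KZ.relations.sub_mem
    (KZ.relations.sum_mem fun k _ => KZ.relations.zsmul_mem (KZ.relations.add_mem (h1 k) (h2 k)) _) h3

end CubeStokesSplit

/-! ### `CubeStokes` -/

/-- **Settles stmt-KontsevichZagierPeriods-5566 (`CubeStokes`)**: closed-form Stokes on the unit cube
is a relation of the Kontsevich–Zagier calculus — the assembly `CubeStokesSplit.cubeStokes_of_subs`
fed with the three landed pieces `CubeLastNewtonLeibniz.cubeLastNewtonLeibniz_proof`,
`CubeCoordinateCycle.cubeCoordinateCycle_proof`, `ZeroCombination.zeroCombination_proof`.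
[cite: KontsevichZagier2001, §1.2] -/
theorem cubeStokes_proof : CubeStokes :=
  CubeStokesSplit.cubeStokes_of_subs CubeLastNewtonLeibniz.cubeLastNewtonLeibniz_proof
    CubeCoordinateCycle.cubeCoordinateCycle_proof ZeroCombination.zeroCombination_proof

end Summit.KontsevichZagierPeriods.CobordismMove
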